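import Summits.Ventures.LatticeQCDFlow.Scaling.DominatedStarMixingCeiling

/-!
HONEST FRAMING: exact (Metropolis-corrected) sampling algorithms for lattice gauge theory; figures
of merit are autocorrelation/cost numbers at stated couplings and volumes; no continuum-physics
claim.

# DominatedStarGapAndMixing — EVERY EIGENVALUE `λ ≠ 1` OF THE MAP-ASSISTED HOT-REFRESHED HUB HAS `|λ| ≤ 1 − tcp/(2m)`
# UNDER ONE-SIDED DOMINATION `p·μ_l(φ_r u) ≤ μ_0(u)` AND `4t ≤ p(1−t)w_0`: ABSOLUTE SPECTRAL GAP `γ⋆ ≥ tcp/(2m)`,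
# RELAXATION TIME `t_rel ≤ 2m/(tcp)`, AND `(t_rel − 1)·log(1/(2ε)) ≤ t_mix(ε) ≤ ⌈(2m/(tcp))·log((2K+p)/(pε))⌉`; WITH
# PERFECT TRANSPORTS `γ⋆ ≥ t(1−t)w_0c/(2m)` FOR ANY LAWS, MAPS AND WEIGHTS (lean-2 GEN-26, ours)

Venture-side (OURS).  Cell `lqcd-flow` (pub-lqcd), unit `pub-lqcd-lean-2-g26`, 2026-08-27.  Chapter M (the
coupon-collector ceiling without perfect transports), file 13 — the spectral reading of the ceiling.  The geometric
distance profile `d(n) ≤ C·ρⁿ` of `Scaling/DominatedStarMixingCeiling` (`C = (2K+p)/p`, `ρ = 1 − tcp/(2m)`) bounds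
EVERY non-trivial eigenvalue: `|λ|ⁿ ≤ 2d(n) ≤ 2Cρⁿ` for all `n` (Levin–Peres–Wilmer eq. (12.15), in the tree) forces
`|λ| ≤ ρ` — no logarithm is lost, and no reversibility is used beyond the stationarity it provides.  Setting as in
that file; the cold kernels are taken `μ_k`-reversible so that the scheme is `π̃`-reversible (`π̃ = ⊗μ_k`) and in
particular `π̃`-stationary.

## What is proved

* §0 (any finite chain) **`lambdaStar_le_of_worstTvDist_le_geom`** — `πP = π`, `0 < ρ`, `d(n) ≤ Cρⁿ` for all `n` ⇒
  `λ⋆ ≤ ρ`; `absSpectralGap_ge_of_worstTvDist_le_geom` (`γ⋆ ≥ 1 − ρ`); `relaxationTime_le_of_worstTvDist_le_geom`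
  (`ρ < 1` ⇒ `t_rel ≤ 1/(1−ρ)`).
* §1 **`dominatedStar_detailedBalance`**, `dominatedStar_isStationary` — the scheme is `π̃`-reversible;
  **`dominatedStar_lambdaStar_le`** — `λ⋆ ≤ 1 − tcp/(2m)`; **`dominatedStar_absSpectralGap_ge`** — `γ⋆ ≥ tcp/(2m)`;
  **`dominatedStar_relaxationTime_le`** — `t_rel ≤ 2m/(tcp)`; **`dominatedStar_relaxation_mixing_two_sided`** —
  `(t_rel − 1)·log(1/(2ε)) ≤ t_mix(ε) ≤ ⌈(2m/(tcp))·log((2K+p)/(pε))⌉` (`0 < ε`).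
* §2 **`perfectStar_lambdaStar_le`**, **`perfectStar_absSpectralGap_ge`**, `perfectStar_relaxationTime_le` — perfect
  transports, `0 < t < 1`, `w_0 > 0`: `λ⋆ ≤ 1 − t(1−t)w_0c/(2m)`, `γ⋆ ≥ t(1−t)w_0c/(2m)`, `t_rel ≤ 2m/(t(1−t)w_0c)`.

Reading (no numerics implied): in the regime `4t ≤ p(1−t)w_0` the absolute spectral gap of the real map-assisted
hub is at least the rarest hub edge's proposal frequency `c/m` times `tp/2` — to be set against chapter K's
`Scaling/HubProposalLaw` (floor `p·min{tc/(6m), γ₀(1−t)/(14K)}` for general hot kernels of gap `γ₀`, ceiling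
`t·c_k/(2m·v)` for the variational gap): with the exact hot sampler the rate is `tcp/(2m)` with no `K⁻¹` term and the
constant `1/2`.  NOT CLAIMED: the variational gap `γ = 1 − λ₂` is `≥ γ⋆` only for irreducible reversible chains
(`ReversibleSpectrumReal.absSpectralGap_le_spectralGap`; irreducibility of the scheme is recorded in the sequel);
optimality of `1/2`; anything outside the regime for imperfect maps; anything measured.  Literature grade (cell rule):
OWN RESULT on the tree's Levin–Peres–Wilmer eq. (12.15) (`norm_eigenvalue_pow_le_two_mul_worstTvDist`) and
eq. (12.14); nothing cited as a fact; no new bib keys.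
-/

noncomputable section

open Finset Function Filter
open Literature.Probability.MarkovChains

namespace Summit.Ventures.LatticeQCDFlow.Scaling

/-! ## §0 A geometric distance profile bounds every non-trivial eigenvalue -/

/-- **`d(n) ≤ C·ρⁿ` FOR ALL `n` (`πP = π`, `ρ > 0`) ⇒ `λ⋆ ≤ ρ`:** every eigenvalue `λ ≠ 1` has `|λ|ⁿ ≤ 2d(n) ≤ 2Cρⁿ`,
and `(|λ|/ρ)ⁿ` bounded forces `|λ| ≤ ρ`. [ours] -/
theorem lambdaStar_le_of_worstTvDist_le_geom {X : Type*} [Fintype X] [DecidableEq X] {P : X → X → ℝ} {π : X → ℝ}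
    (hπ : IsStationary π P) {C ρ : ℝ} (hρ : 0 < ρ) (hd : ∀ n : ℕ, worstTvDist P π n ≤ C * ρ ^ n) :
    lambdaStar P ≤ ρ := by
  by_cases h : (nontrivialEigenvalues P).Nonempty
  · obtain ⟨μ, hμ, hμeq⟩ := exists_norm_eq_lambdaStar h
    obtain ⟨f, hf⟩ := hμ.1.exists_hasEigenvector
    obtain ⟨hf0, hfx⟩ := (hasEigenvector_iff P f μ).mp hf
    rw [← hμeq]
    by_contra hlt
    push Not at hlt
    have hr : 1 < ‖μ‖ / ρ := by rw [lt_div_iff₀ hρ, one_mul]; exact hlt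
    have hpow : ∀ n : ℕ, (‖μ‖ / ρ) ^ n ≤ 2 * C := by
      intro n
      have h1 := norm_eigenvalue_pow_le_two_mul_worstTvDist hπ hfx hf0 hμ.2 n
      have h2 : ‖μ‖ ^ n ≤ 2 * C * ρ ^ n := by nlinarith [hd n, h1]
      rw [div_pow, div_le_iff₀ (pow_pos hρ n)]
      exact h2
    have htend := tendsto_pow_atTop_atTop_of_one_lt hr
    obtain ⟨n, hn⟩ := (htend.eventually (eventually_gt_atTop (2 * C))).exists
    exact absurd (hpow n) (not_le.mpr hn)
  · unfold lambdaStar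
    rw [Set.not_nonempty_iff_eq_empty.mp h, Set.image_empty, Real.sSup_empty]
    exact hρ.le

/-- **`d(n) ≤ C·ρⁿ` for all `n` ⇒ `γ⋆ ≥ 1 − ρ`.** [ours] -/
theorem absSpectralGap_ge_of_worstTvDist_le_geom {X : Type*} [Fintype X] [DecidableEq X] {P : X → X → ℝ}
    {π : X → ℝ} (hπ : IsStationary π P) {C ρ : ℝ} (hρ : 0 < ρ) (hd : ∀ n : ℕ, worstTvDist P π n ≤ C * ρ ^ n) :
    1 - ρ ≤ absSpectralGap P := by
  unfold absSpectralGap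
  linarith [lambdaStar_le_of_worstTvDist_le_geom hπ hρ hd]

/-- **`d(n) ≤ C·ρⁿ` for all `n`, `0 < ρ < 1` ⇒ `t_rel ≤ 1/(1 − ρ)`.** [ours] -/
theorem relaxationTime_le_of_worstTvDist_le_geom {X : Type*} [Fintype X] [DecidableEq X] {P : X → X → ℝ}
    {π : X → ℝ} (hπ : IsStationary π P) {C ρ : ℝ} (hρ : 0 < ρ) (hρ1 : ρ < 1)
    (hd : ∀ n : ℕ, worstTvDist P π n ≤ C * ρ ^ n) : relaxationTime P ≤ 1 / (1 - ρ) := by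
  unfold relaxationTime
  exact one_div_le_one_div_of_le (by linarith) (absSpectralGap_ge_of_worstTvDist_le_geom hπ hρ hd)

variable {S : Type*} [Fintype S] [DecidableEq S] {K m : ℕ} {μ : Fin (K + 1) → S → ℝ} {M : Fin (K + 1) → S → S → ℝ}
  {w : Fin (K + 1) → ℝ} {t p : ℝ}

section Gap
variable (κ : Fin m → Fin K) (φ : Fin m → Equiv.Perm S)

/-! ## §1 One-sided domination -/

/-- The scheme `t·GSw + (1−t)·Π_w^M` is `π̃`-reversible for `μ_k`-reversible cold kernels (any `t`, `w`, maps). [ours] -/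
theorem dominatedStar_detailedBalance (hμ : ∀ k x, 0 < μ k x) (hMrev : ∀ k, DetailedBalance (μ k) (M k)) :
    DetailedBalance (tensorFun μ) (fun y z : Fin (K + 1) → S =>
        t * ptGraphSwap μ (fun r : Fin m => (((0 : Fin (K + 1)), (κ r).succ) : Fin (K + 1) × Fin (K + 1))) φ y z
          + (1 - t) * prodKernel w M y z) :=
  weightedScheme_detailedBalance (ptGraphSwap_detailedBalance hμ) hMrev t

/-- The scheme is `π̃`-stationary (`0 ≤ t ≤ 1`, `w` a probability vector, reversible cold kernels). [ours] -/
theorem dominatedStar_isStationary (ht0 : 0 ≤ t) (ht1 : t ≤ 1) (hw0 : ∀ k, 0 ≤ w k) (hw1 : ∑ k, w k = 1)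
    (hμ : ∀ k x, 0 < μ k x) (hM : ∀ k, IsRowStochastic (M k)) (hMrev : ∀ k, DetailedBalance (μ k) (M k)) :
    IsStationary (tensorFun μ) (fun y z : Fin (K + 1) → S =>
        t * ptGraphSwap μ (fun r : Fin m => (((0 : Fin (K + 1)), (κ r).succ) : Fin (K + 1) × Fin (K + 1))) φ y z
          + (1 - t) * prodKernel w M y z) :=
  (dominatedStar_detailedBalance κ φ hμ hMrev).isStationary
    (weightedScheme_isRowStochastic (t := t) (w := w)
      (ptGraphSwap_isRowStochastic (e := fun r : Fin m => (((0 : Fin (K + 1)), (κ r).succ) : Fin (K + 1) × Fin (K + 1)))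
        (φ := φ) hμ) hM hw0 hw1 ht0 ht1).2

/-- **EVERY EIGENVALUE `λ ≠ 1` HAS `|λ| ≤ 1 − tcp/(2m)`: `λ⋆ ≤ 1 − tcp/(2m)`** under one-sided domination
`p·μ_{l_r}(φ_r u) ≤ μ_0(u)` (`0 < p ≤ 1`), `4t ≤ p(1−t)w_0`, exact hot sampler, reversible cold kernels, hub
multiplicities `≥ c ≥ 1`. [ours] -/
theorem dominatedStar_lambdaStar_le (hm : 1 ≤ m) (ht0 : 0 ≤ t) (ht1 : t ≤ 1) (hw0 : ∀ k, 0 ≤ w k)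
    (hw1 : ∑ k, w k = 1) (hμ : ∀ k x, 0 < μ k x) (hμ1 : ∀ k, ∑ u, μ k u = 1) (hM : ∀ k, IsRowStochastic (M k))
    (hMrev : ∀ k, DetailedBalance (μ k) (M k)) (hM0 : ∀ u v, M 0 u v = μ 0 v) (hp0 : 0 < p) (hp1 : p ≤ 1)
    (hdom : ∀ r u, p * μ (κ r).succ (φ r u) ≤ μ 0 u) (hreg : 4 * t ≤ p * (1 - t) * w 0)
    {c : ℕ} (hc1 : 1 ≤ c) (hc : ∀ p' : Fin K, c ≤ (univ.filter (fun r : Fin m => κ r = p')).card) (hcm : c ≤ m) :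
    lambdaStar (fun y z : Fin (K + 1) → S =>
        t * ptGraphSwap μ (fun r : Fin m => (((0 : Fin (K + 1)), (κ r).succ) : Fin (K + 1) × Fin (K + 1))) φ y z
          + (1 - t) * prodKernel w M y z) ≤ 1 - t * c * p / (2 * m) := by
  have hstat : ∀ k : Fin (K + 1), k ≠ 0 → ∀ v, ∑ u, μ k u * M k u v = μ k v :=
    fun k _ v => (hMrev k).isStationary (hM k).2 v
  have hmpos : (0 : ℝ) < m := Nat.cast_pos.mpr (by omega)
  have hcm' : (c : ℝ) ≤ m := by exact_mod_cast hcm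
  have hρ : 0 < 1 - t * c * p / (2 * m) := by
    rw [sub_pos, div_lt_one (by positivity)]
    have h1 : t * c * p ≤ 1 * m * 1 := by
      have := mul_le_mul (mul_le_mul ht1 hcm' (Nat.cast_nonneg c) zero_le_one) hp1 hp0.le (by positivity)
      linarith
    linarith
  exact lambdaStar_le_of_worstTvDist_le_geom (dominatedStar_isStationary κ φ ht0 ht1 hw0 hw1 hμ hM hMrev) hρ
    (dominatedStar_worstTvDist_le_oneSided κ φ hm ht0 ht1 hw0 hw1 hμ hμ1 hM hM0 hstat hp0 hp1 hdom hreg hc1 hc hcm)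

/-- **THE ABSOLUTE SPECTRAL GAP: `γ⋆ ≥ tcp/(2m)`** under one-sided domination and `4t ≤ p(1−t)w_0`. [ours] -/
theorem dominatedStar_absSpectralGap_ge (hm : 1 ≤ m) (ht0 : 0 ≤ t) (ht1 : t ≤ 1) (hw0 : ∀ k, 0 ≤ w k)
    (hw1 : ∑ k, w k = 1) (hμ : ∀ k x, 0 < μ k x) (hμ1 : ∀ k, ∑ u, μ k u = 1) (hM : ∀ k, IsRowStochastic (M k))
    (hMrev : ∀ k, DetailedBalance (μ k) (M k)) (hM0 : ∀ u v, M 0 u v = μ 0 v) (hp0 : 0 < p) (hp1 : p ≤ 1)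
    (hdom : ∀ r u, p * μ (κ r).succ (φ r u) ≤ μ 0 u) (hreg : 4 * t ≤ p * (1 - t) * w 0)
    {c : ℕ} (hc1 : 1 ≤ c) (hc : ∀ p' : Fin K, c ≤ (univ.filter (fun r : Fin m => κ r = p')).card) (hcm : c ≤ m) :
    t * c * p / (2 * m) ≤ absSpectralGap (fun y z : Fin (K + 1) → S =>
        t * ptGraphSwap μ (fun r : Fin m => (((0 : Fin (K + 1)), (κ r).succ) : Fin (K + 1) × Fin (K + 1))) φ y z
          + (1 - t) * prodKernel w M y z) := by
  unfold absSpectralGap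
  linarith [dominatedStar_lambdaStar_le κ φ hm ht0 ht1 hw0 hw1 hμ hμ1 hM hMrev hM0 hp0 hp1 hdom hreg hc1 hc hcm]

/-- **THE RELAXATION TIME: `t_rel ≤ 2m/(tcp)`** under one-sided domination and `4t ≤ p(1−t)w_0` (`0 < t`). [ours] -/
theorem dominatedStar_relaxationTime_le (hm : 1 ≤ m) (ht0 : 0 < t) (ht1 : t ≤ 1) (hw0 : ∀ k, 0 ≤ w k)
    (hw1 : ∑ k, w k = 1) (hμ : ∀ k x, 0 < μ k x) (hμ1 : ∀ k, ∑ u, μ k u = 1) (hM : ∀ k, IsRowStochastic (M k))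
    (hMrev : ∀ k, DetailedBalance (μ k) (M k)) (hM0 : ∀ u v, M 0 u v = μ 0 v) (hp0 : 0 < p) (hp1 : p ≤ 1)
    (hdom : ∀ r u, p * μ (κ r).succ (φ r u) ≤ μ 0 u) (hreg : 4 * t ≤ p * (1 - t) * w 0)
    {c : ℕ} (hc1 : 1 ≤ c) (hc : ∀ p' : Fin K, c ≤ (univ.filter (fun r : Fin m => κ r = p')).card) (hcm : c ≤ m) :
    relaxationTime (fun y z : Fin (K + 1) → S =>
        t * ptGraphSwap μ (fun r : Fin m => (((0 : Fin (K + 1)), (κ r).succ) : Fin (K + 1) × Fin (K + 1))) φ y z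
          + (1 - t) * prodKernel w M y z) ≤ 2 * m / (t * c * p) := by
  have hmpos : (0 : ℝ) < m := Nat.cast_pos.mpr (by omega)
  have hcpos : (0 : ℝ) < c := Nat.cast_pos.mpr (by omega)
  have hgap := dominatedStar_absSpectralGap_ge κ φ hm ht0.le ht1 hw0 hw1 hμ hμ1 hM hMrev hM0 hp0 hp1 hdom hreg hc1 hc hcm
  have hpos : 0 < t * c * p / (2 * m) := by positivity
  unfold relaxationTime
  calc 1 / absSpectralGap _ ≤ 1 / (t * c * p / (2 * m)) := one_div_le_one_div_of_le hpos hgap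
    _ = 2 * m / (t * c * p) := by rw [one_div_div]

/-- **RELAXATION AND MIXING, BOTH SIDES: `(t_rel − 1)·log(1/(2ε)) ≤ t_mix(ε) ≤ ⌈(2m/(tcp))·log((2K+p)/(pε))⌉`**
(`0 < ε`, `0 < t`; Levin–Peres–Wilmer eq. (12.14) from the tree on the left). [ours] -/
theorem dominatedStar_relaxation_mixing_two_sided (hm : 1 ≤ m) (ht0 : 0 < t) (ht1 : t ≤ 1) (hw0 : ∀ k, 0 ≤ w k)
    (hw1 : ∑ k, w k = 1) (hμ : ∀ k x, 0 < μ k x) (hμ1 : ∀ k, ∑ u, μ k u = 1) (hM : ∀ k, IsRowStochastic (M k))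
    (hMrev : ∀ k, DetailedBalance (μ k) (M k)) (hM0 : ∀ u v, M 0 u v = μ 0 v) (hp0 : 0 < p) (hp1 : p ≤ 1)
    (hdom : ∀ r u, p * μ (κ r).succ (φ r u) ≤ μ 0 u) (hreg : 4 * t ≤ p * (1 - t) * w 0)
    {c : ℕ} (hc1 : 1 ≤ c) (hc : ∀ p' : Fin K, c ≤ (univ.filter (fun r : Fin m => κ r = p')).card) (hcm : c ≤ m)
    {ε : ℝ} (hε : 0 < ε) :
    (relaxationTime (fun y z : Fin (K + 1) → S =>
        t * ptGraphSwap μ (fun r : Fin m => (((0 : Fin (K + 1)), (κ r).succ) : Fin (K + 1) × Fin (K + 1))) φ y z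
          + (1 - t) * prodKernel w M y z) - 1) * Real.log (1 / (2 * ε))
        ≤ (mixingTime (fun y z : Fin (K + 1) → S =>
            t * ptGraphSwap μ (fun r : Fin m => (((0 : Fin (K + 1)), (κ r).succ) : Fin (K + 1) × Fin (K + 1))) φ y z
              + (1 - t) * prodKernel w M y z) (tensorFun μ) ε : ℝ) ∧
      mixingTime (fun y z : Fin (K + 1) → S =>
            t * ptGraphSwap μ (fun r : Fin m => (((0 : Fin (K + 1)), (κ r).succ) : Fin (K + 1) × Fin (K + 1))) φ y z
              + (1 - t) * prodKernel w M y z) (tensorFun μ) ε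
        ≤ ⌈2 * (m : ℝ) / (t * c * p) * Real.log ((2 * (K : ℝ) + p) / (p * ε))⌉₊ := by
  have hstat : ∀ k : Fin (K + 1), k ≠ 0 → ∀ v, ∑ u, μ k u * M k u v = μ k v :=
    fun k _ v => (hMrev k).isStationary (hM k).2 v
  have hmpos : (0 : ℝ) < m := Nat.cast_pos.mpr (by omega)
  have hcpos : (0 : ℝ) < c := Nat.cast_pos.mpr (by omega)
  refine ⟨?_, dominatedStar_mixingTime_le κ φ hm ht0 ht1 hw0 hw1 hμ hμ1 hM hM0 hstat hp0 hp1 hdom hreg hc1 hc hcm hε⟩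
  have hlam : lambdaStar (fun y z : Fin (K + 1) → S =>
      t * ptGraphSwap μ (fun r : Fin m => (((0 : Fin (K + 1)), (κ r).succ) : Fin (K + 1) × Fin (K + 1))) φ y z
        + (1 - t) * prodKernel w M y z) < 1 := by
    have h := dominatedStar_lambdaStar_le κ φ hm ht0.le ht1 hw0 hw1 hμ hμ1 hM hMrev hM0 hp0 hp1 hdom hreg hc1 hc hcm
    have hpos : 0 < t * c * p / (2 * m) := by positivity
    linarith
  exact LevinPeres2017_eq_12_14_tmix (dominatedStar_isStationary κ φ ht0.le ht1 hw0 hw1 hμ hM hMrev) hlam hε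
    ⟨_, dominatedStar_worstTvDist_le_of_ge_log κ φ hm ht0 ht1 hw0 hw1 hμ hμ1 hM hM0 hstat hp0 hp1 hdom hreg hc1 hc hcm hε
      (Nat.le_ceil _)⟩

/-! ## §2 Perfect transports: arbitrary laws, maps and update weights -/

/-- **PERFECT TRANSPORTS: `λ⋆ ≤ 1 − t(1−t)w_0c/(2m)`** (`0 < t < 1`, `w_0 > 0`, any laws, maps, weights; reversible
cold kernels, exact hot sampler). [ours] -/
theorem perfectStar_lambdaStar_le (hm : 1 ≤ m) (ht0 : 0 < t) (ht1 : t < 1) (hw0 : ∀ k, 0 ≤ w k) (hw00 : 0 < w 0)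
    (hw1 : ∑ k, w k = 1) (hμ : ∀ k x, 0 < μ k x) (hμ1 : ∀ k, ∑ u, μ k u = 1) (hM : ∀ k, IsRowStochastic (M k))
    (hMrev : ∀ k, DetailedBalance (μ k) (M k)) (hM0 : ∀ u v, M 0 u v = μ 0 v)
    (hperf : ∀ r u, μ (κ r).succ (φ r u) = μ 0 u)
    {c : ℕ} (hc1 : 1 ≤ c) (hc : ∀ p' : Fin K, c ≤ (univ.filter (fun r : Fin m => κ r = p')).card) (hcm : c ≤ m) :
    lambdaStar (fun y z : Fin (K + 1) → S =>
        t * ptGraphSwap μ (fun r : Fin m => (((0 : Fin (K + 1)), (κ r).succ) : Fin (K + 1) × Fin (K + 1))) φ y z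
          + (1 - t) * prodKernel w M y z) ≤ 1 - t * (1 - t) * w 0 * c / (2 * m) := by
  have hstat : ∀ k : Fin (K + 1), k ≠ 0 → ∀ v, ∑ u, μ k u * M k u v = μ k v :=
    fun k _ v => (hMrev k).isStationary (hM k).2 v
  have hmpos : (0 : ℝ) < m := Nat.cast_pos.mpr (by omega)
  have hcm' : (c : ℝ) ≤ m := by exact_mod_cast hcm
  have hw01 : w 0 ≤ 1 := by
    have h := Finset.single_le_sum (f := w) (fun k _ => hw0 k) (mem_univ (0 : Fin (K + 1)))
    rw [hw1] at h; exact h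
  have hρ : 0 < 1 - t * (1 - t) * w 0 * c / (2 * m) := by
    rw [sub_pos, div_lt_one (by positivity)]
    have h1 : t * (1 - t) ≤ 1 := by nlinarith
    have h2 : t * (1 - t) * w 0 ≤ 1 := by nlinarith
    have h3 : t * (1 - t) * w 0 * c ≤ 1 * m := by nlinarith
    linarith
  exact lambdaStar_le_of_worstTvDist_le_geom (dominatedStar_isStationary κ φ ht0.le ht1.le hw0 hw1 hμ hM hMrev) hρ
    (perfectStar_worstTvDist_le κ φ hm ht0 ht1 hw0 hw00 hw1 hμ hμ1 hM hM0 hstat hperf hc1 hc hcm)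

/-- **PERFECT TRANSPORTS: `γ⋆ ≥ t(1−t)w_0c/(2m)`.** [ours] -/
theorem perfectStar_absSpectralGap_ge (hm : 1 ≤ m) (ht0 : 0 < t) (ht1 : t < 1) (hw0 : ∀ k, 0 ≤ w k) (hw00 : 0 < w 0)
    (hw1 : ∑ k, w k = 1) (hμ : ∀ k x, 0 < μ k x) (hμ1 : ∀ k, ∑ u, μ k u = 1) (hM : ∀ k, IsRowStochastic (M k))
    (hMrev : ∀ k, DetailedBalance (μ k) (M k)) (hM0 : ∀ u v, M 0 u v = μ 0 v)
    (hperf : ∀ r u, μ (κ r).succ (φ r u) = μ 0 u)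
    {c : ℕ} (hc1 : 1 ≤ c) (hc : ∀ p' : Fin K, c ≤ (univ.filter (fun r : Fin m => κ r = p')).card) (hcm : c ≤ m) :
    t * (1 - t) * w 0 * c / (2 * m) ≤ absSpectralGap (fun y z : Fin (K + 1) → S =>
        t * ptGraphSwap μ (fun r : Fin m => (((0 : Fin (K + 1)), (κ r).succ) : Fin (K + 1) × Fin (K + 1))) φ y z
          + (1 - t) * prodKernel w M y z) := by
  unfold absSpectralGap
  linarith [perfectStar_lambdaStar_le κ φ hm ht0 ht1 hw0 hw00 hw1 hμ hμ1 hM hMrev hM0 hperf hc1 hc hcm]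

/-- **PERFECT TRANSPORTS: `t_rel ≤ 2m/(t(1−t)w_0c)`.** [ours] -/
theorem perfectStar_relaxationTime_le (hm : 1 ≤ m) (ht0 : 0 < t) (ht1 : t < 1) (hw0 : ∀ k, 0 ≤ w k) (hw00 : 0 < w 0)
    (hw1 : ∑ k, w k = 1) (hμ : ∀ k x, 0 < μ k x) (hμ1 : ∀ k, ∑ u, μ k u = 1) (hM : ∀ k, IsRowStochastic (M k))
    (hMrev : ∀ k, DetailedBalance (μ k) (M k)) (hM0 : ∀ u v, M 0 u v = μ 0 v)
    (hperf : ∀ r u, μ (κ r).succ (φ r u) = μ 0 u)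
    {c : ℕ} (hc1 : 1 ≤ c) (hc : ∀ p' : Fin K, c ≤ (univ.filter (fun r : Fin m => κ r = p')).card) (hcm : c ≤ m) :
    relaxationTime (fun y z : Fin (K + 1) → S =>
        t * ptGraphSwap μ (fun r : Fin m => (((0 : Fin (K + 1)), (κ r).succ) : Fin (K + 1) × Fin (K + 1))) φ y z
          + (1 - t) * prodKernel w M y z) ≤ 2 * m / (t * (1 - t) * w 0 * c) := by
  have hmpos : (0 : ℝ) < m := Nat.cast_pos.mpr (by omega)
  have hcpos : (0 : ℝ) < c := Nat.cast_pos.mpr (by omega)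
  have h1t : 0 < 1 - t := by linarith
  have hgap := perfectStar_absSpectralGap_ge κ φ hm ht0 ht1 hw0 hw00 hw1 hμ hμ1 hM hMrev hM0 hperf hc1 hc hcm
  have hpos : 0 < t * (1 - t) * w 0 * c / (2 * m) := by positivity
  unfold relaxationTime
  calc 1 / absSpectralGap _ ≤ 1 / (t * (1 - t) * w 0 * c / (2 * m)) := one_div_le_one_div_of_le hpos hgap
    _ = 2 * m / (t * (1 - t) * w 0 * c) := by rw [one_div_div]

end Gap

end Summit.Ventures.LatticeQCDFlow.Scaling

end
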